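import Mathlib
import HarnessLib
import Literature.MathematicalPhysics.StatisticalMechanics.AbkmPackageSlotsF4First
import Literature.MathematicalPhysics.StatisticalMechanics.AbkmPackageSlotF4b2

/-!
# `F4Statement d` from its cores: what is LEFT after `L2GaussianCore`, `TwoKernelSkBound` and the packaged
# first-order slots is exactly the two `S_k` slots (F4l2), (F4l') ([ABKM19] Lemma 12.6 (12.53), `ℓ = 2` / mixed)

The named fact `F4Statement d` (`AbkmPackageSlots`) bundles nine `q`-slots with `N`-free sizes.  Seven of them are
now theorems or named cores: (F4a), (F4b), (F4a2), (F4Φ2) — `exists_f4first_unif`; (F4b2), (F4Φ22) —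
`l2GaussianCore`; (F4l) — the named fact `TwoKernelSkBound d`.  This file records the honest residual of the
route child `F4StatementOfCores` as ONE implication:

* **`f4Statement_of_cores`** — `TwoKernelSkBound d → (∀ P, ∃ l_TT l_T' ≥ 0, ∀ N M Q, F4l2 ∧ F4l') → F4Statement d`
  (`L2GaussianCore d` is USED as the theorem `l2GaussianCore`, not assumed; the hypothesis = the two `S_k`
  slots that need the Banach-grade two-kernel machinery at second / mixed order);
* `f4StatementOfCores_of_SkSlots` — hence the route child `F4StatementOfCores`
  (= `TwoKernelSkBound 4 → L2GaussianCore 4 → F4Statement 4`) follows from those two slots alone.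

No named fact is assumed; no definition.
Honest scope: rung-route bookkeeping; nothing about superconductivity in the Hubbard model.

## References
* S. Adams, S. Buchholz, R. Kotecký, S. Müller, arXiv:1910.13564, Lemma 12.6 (12.51)–(12.53), Lemma 8.4
  [AdamsBuchholzKoteckyMuller2019].
-/

noncomputable section

namespace Literature.MathematicalPhysics.StatisticalMechanics.GradientRG

variable {d : ℕ}

/-- **`F4Statement d` from its cores**: the volume-uniform two-kernel bound (F4l, the named fact
`TwoKernelSkBound`), the two `S_k` second-order / mixed slots, and — as THEOREMS — the packaged first-order
slots (`exists_f4first_unif`) and the `ℓ = 2` Gaussian core (`l2GaussianCore`).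
[cite: AdamsBuchholzKoteckyMuller2019, Lemma 12.6 (12.51)–(12.53) / Lemma 8.4] -/
theorem f4Statement_of_cores (hTK : TwoKernelSkBound d)
    (hSk : ∀ (P : PackageData d) [Fact (0 < P.h)] [Fact (0 < P.L)],
      ∃ lTT lT' : ℝ, 0 ≤ lTT ∧ 0 ≤ lT' ∧
        ∀ (N M : ℕ) [NeZero M] (Q : PackageAt P N M), F4l2 P Q lTT ∧ F4l' P Q lT') :
    F4Statement d := by
  intro P _ _
  obtain ⟨aT, bT, aTT, φT, haT, hbT, haTT, hφT, hfirst⟩ := exists_f4first_unif P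
  obtain ⟨lT, hlT, hl⟩ := hTK P
  obtain ⟨lTT, lT', hlTT, hlT', hSk'⟩ := hSk P
  obtain ⟨bTT, φTT, hbTT, hφTT, hcore⟩ := l2GaussianCore (d := d) P
  refine ⟨aT, bT, lT, aTT, bTT, lTT, lT', φT, φTT, haT, hbT, hlT, haTT, hbTT, hlTT, hlT', hφT, hφTT,
    fun N M _ Q => ?_⟩
  obtain ⟨ha, hb, ha2, hΦ2⟩ := hfirst N M Q
  obtain ⟨hb2, hΦ22⟩ := hcore N M Q
  obtain ⟨hl2, hl'⟩ := hSk' N M Q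
  exact ⟨ha, hb, hl N M Q, ha2, hb2, hl2, hl', hΦ2, hΦ22⟩

/-- **The route child `F4StatementOfCores` reduced to the `S_k` slots**:
`(∀ P, ∃ sizes, F4l2 ∧ F4l') → (TwoKernelSkBound d → L2GaussianCore d → F4Statement d)`.
[cite: AdamsBuchholzKoteckyMuller2019, Lemma 12.6] -/
theorem f4StatementOfCores_of_SkSlots
    (hSk : ∀ (P : PackageData d) [Fact (0 < P.h)] [Fact (0 < P.L)],
      ∃ lTT lT' : ℝ, 0 ≤ lTT ∧ 0 ≤ lT' ∧
        ∀ (N M : ℕ) [NeZero M] (Q : PackageAt P N M), F4l2 P Q lTT ∧ F4l' P Q lT') :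
    TwoKernelSkBound d → L2GaussianCore d → F4Statement d :=
  fun hTK _ => f4Statement_of_cores hTK hSk

end Literature.MathematicalPhysics.StatisticalMechanics.GradientRG

end
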